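import Mathlib
import Summits.ResolutionOfSingularities.ResolutionOfSingularities.Theorems.WeightedInvariantLocalWeightedDropTOT2StepBlowOne

/-!
# TOT2-LINE (P3) B6 step 6/6: THE GRAPH MOVE — the budget does not rise

Sub-problem `ResolutionOfSingularities`, ENGINE crux `stmt-ResolutionOfSingularities-8899` (`LocalWeightedDrop`), skeleton v35 (2e806da509994632),
registered stub `stub_conflictBudget` (P3); plan `L/res-L1-w43-stub-2/g6/B6-PLAN.md` §1, §4.  [OURS · L1 W4.3 · chain w43 · res-L1-w43-stub-2 g6 (owner
of (P3)); def-free; the bricks B3 / B4 / D3 v2 / injectivity of `comap` for the COMPOSITE chart `Φ = chartDivTwo ∘ recentre ψ ∘ shear h₀` and the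
no-line fact (D8: a well-prepared label off `Perm2` has no one-dimensional top-locus prime through `V(u₂)` off `V(u₁)`) are taken as typed HYPOTHESES
on an abstract `k`-algebra endomorphism `Φ` (only `Φ u₁ = u₁`, `Φ (u₂ − u₁h₀) = u₂`, `Φ (toThree g) = toThree (φ₂ g)` are used), to be
discharged by name in the glue; nothing here is a statement of any manuscript; AI-produced, gate-checked, weaker than expert review.]

The move: `¬Perm1`, `¬Perm2`, a graph curve with datum `(h₀, ψ)` (`h₀ = h₀(u₁)`), `u₂ ∉ N`; successor `A′` (abstract; in the glue
`divTwoT d (shift d (shearT h₀ A) ψ₁)`), `u₂ ∈ N′`.  So `β = 0`, `β′ = 1`: every surviving branch is charged births `2(b′ − m′) + κ′ ≤ 2b′ − 1`,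
paid by its pair term with the DYING graph prime `P_Γ ∋ u₂ − u₁h₀` of `A` (`exists_graphPrimeNL`: `u₂ ∉ P_Γ` by well-prepared minimality, as in D5):
D7 gives `pair(P, P_Γ) ≥ v_P(u₂ − u₁h₀) = v_{P′}(u₂) = b′`.  Pairs among survivors do not increase (`u = 1`).  `budget_comparison` concludes.
* `exists_graphPrimeNL`, `conflictBudgetD_graph_le`.
-/

set_option linter.dupNamespace false -- mandated namespace of this single-conjunct summit

noncomputable section

namespace Summit.ResolutionOfSingularities.ResolutionOfSingularities.Theorems

namespace TOT2Branch

open MvPowerSeries IsLocalRing PolyDescent MonicDescent WildMonic Literature.AlgebraicGeometry.Resolution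

variable {k : Type} [Field k]

/-- **The graph prime is a non-line top-locus prime** when the label is well-prepared, positive and off `Perm2`: the prime of the graph datum
`(h, ψ)` contains `u₂ − u₁h`, not `u₁`, and not `u₂` (`h ≠ 0` by `isPermissibleTwoT_of_shift`). -/
theorem exists_graphPrimeNL {d : ℕ} (hd : 0 < d) {A : Fin d → MvPowerSeries (Fin 2) k} (hWP : WellPrepared d A) (hpos : IsPosT d A)
    (h2 : ¬ IsPermissibleTwoT d A) {h ψ : MvPowerSeries (Fin 2) k} (hh : ∀ e : Fin 2 →₀ ℕ, e 1 ≠ 0 → coeff e h = 0)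
    (hψ : constantCoeff ψ = 0) (hperm : IsPermissibleTwoT d (shift d (shearT h A) ψ)) :
    ∃ P ∈ topPrimesNL d A, (X 1 - X 0 * toThree h : MvPowerSeries (Fin 3) k) ∈ P := by
  obtain ⟨P, hP, hX0, hlin, hF, hzero, -⟩ := exists_graphPrime A hh hψ hperm
  haveI := hP
  have hh0 : h ≠ 0 := by
    rintro rfl
    rw [shearT_zero] at hperm
    exact h2 (isPermissibleTwoT_of_shift hd hWP hpos hψ hperm)
  have hX1 : (X 1 : MvPowerSeries (Fin 3) k) ∉ P := by
    intro h1
    have h3 : (X 0 : MvPowerSeries (Fin 3) k) * toThree h ∈ P := by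
      have := Ideal.sub_mem P h1 hlin; rwa [sub_sub_cancel] at this
    have h4 : toThree h ∈ P := (hP.mem_or_mem h3).resolve_left hX0
    exact hh0 (hzero h hh h4)
  have hPm : P ≠ maximalIdeal (MvPowerSeries (Fin 3) k) := fun e => hX0 (e ▸ X_mem_maximalIdeal k (Fin 3) 0)
  exact ⟨P, ⟨⟨hP, hPm, 1, fun h1 => hP.ne_top ((Ideal.eq_top_iff_one P).mpr h1), by rwa [one_mul]⟩, hX0, hX1⟩, hlin⟩

/-! ## The step theorem -/

section Step

variable {d : ℕ} {A A' : Fin d → MvPowerSeries (Fin 2) k} {N N' : Finset (Fin 2)}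
  (Φ : MvPowerSeries (Fin 3) k →ₐ[k] MvPowerSeries (Fin 3) k)

/-- **B6 STEP GRAPH MOVE.**  Under the context for `(A, N)`, `InPoly d A`, `¬Perm2 A`, `u₂ ∉ N`, a graph datum `(h₀, ψ)`, the bricks B3 / B4 / D3 /
injectivity for an abstract chart `Φ` with `Φ u₁ = u₁`, `Φ (u₂ − u₁h₀) = u₂`, `Φ (toThree g) = toThree (φ₂ g)`, and the no-line fact `hNL` for
`A`: for every successor label `A′` with `u₂ ∈ N′`, `M′ ≤ M`. -/
theorem conflictBudgetD_graph_le (p : ℕ) [Fact p.Prime] [CharP k p] [IsAlgClosed k]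
    {h₀ ψ : MvPowerSeries (Fin 2) k} (φ₂ : MvPowerSeries (Fin 2) k → MvPowerSeries (Fin 2) k)
    (hh₀ : ∀ e : Fin 2 →₀ ℕ, e 1 ≠ 0 → coeff e h₀ = 0) (hψ : constantCoeff ψ = 0)
    (hperm : IsPermissibleTwoT d (shift d (shearT h₀ A) ψ))
    (hin : InPoly d A) (h2 : ¬ IsPermissibleTwoT d A) (h1N : (1 : Fin 2) ∉ N)
    (hΦX0 : Φ (X 0) = X 0) (hΦℓ : Φ (X 1 - X 0 * toThree h₀) = X 1)
    (hΦ₂ : ∀ g : MvPowerSeries (Fin 2) k, Φ (toThree g) = toThree (φ₂ g))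
    (hB3 : ∀ (P' : Ideal (MvPowerSeries (Fin 3) k)) [P'.IsPrime], ringKrullDim (MvPowerSeries (Fin 3) k ⧸ P') = 1 →
      (X 1 : MvPowerSeries (Fin 3) k) ∉ P' →
      ringKrullDim (MvPowerSeries (Fin 3) k ⧸ P'.comap Φ) = 1 ∧ ∀ f, branchVal (P'.comap Φ) f = branchVal P' (Φ f))
    (hB4 : ∀ (P' : Ideal (MvPowerSeries (Fin 3) k)), P' ∈ topPrimes d A' → (X 1 : MvPowerSeries (Fin 3) k) ∉ P' →
      P'.comap Φ ∈ topPrimes d A)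
    (hD3 : ∀ (P Q : Ideal (MvPowerSeries (Fin 3) k)), P ∈ topPrimes d A → Q ∈ topPrimes d A → P ≠ Q →
      ringKrullDim (MvPowerSeries (Fin 3) k ⧸ P) = 1 → ringKrullDim (MvPowerSeries (Fin 3) k ⧸ Q) = 1 → pairVal P Q < ⊤)
    (hinj : ∀ (P' Q' : Ideal (MvPowerSeries (Fin 3) k)), P'.IsPrime → Q'.IsPrime → ringKrullDim (MvPowerSeries (Fin 3) k ⧸ P') = 1 →
      ringKrullDim (MvPowerSeries (Fin 3) k ⧸ Q') = 1 → (X 1 : MvPowerSeries (Fin 3) k) ∉ P' → (X 1 : MvPowerSeries (Fin 3) k) ∉ Q' →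
      P'.comap Φ = Q'.comap Φ → P' = Q')
    (hNL : ∀ P ∈ topPrimes d A, ringKrullDim (MvPowerSeries (Fin 3) k ⧸ P) = 1 → (X 0 : MvPowerSeries (Fin 3) k) ∉ P →
      (X 1 : MvPowerSeries (Fin 3) k) ∉ P)
    (hctx : ∃ (b : MvPowerSeries (Fin (2 + 1)) k) (δ : TameFourTupleDrop.Decoration k 2) (Θ : Fin (2 + 1) → MvPowerSeries (Fin (2 + 1)) k),
      TameFourTupleDrop.Admissible b δ ∧ 2 ≤ δ.o ∧ δ.c = d ∧ δ.PresBy d A N Θ)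
    (hN' : (1 : Fin 2) ∈ N') :
    conflictBudgetD d A' N' ≤ conflictBudgetD d A N := by
  classical
  have hd2 : 2 ≤ d := NCBranchPrimes.two_le_of_presContext hctx
  have hsq : Squarefree (NCPoly.monicGerm d A) := NCBranchPrimes.squarefree_monicGerm_of_presContext hctx
  -- the dying graph prime
  obtain ⟨PΓ, hPΓNL, hℓΓ⟩ := exists_graphPrimeNL (by omega) hin.1 hin.2.1 h2 hh₀ hψ hperm
  have hPΓD : PΓ ∈ topPrimesDNL d A :=
    mem_topPrimesDNL_of_mem_topPrimesNL hPΓNL (ringKrullDim_eq_one_of_mem_topPrimes p hd2 hsq hPΓNL.1)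
  haveI : PΓ.IsPrime := hPΓNL.1.1
  -- the letter bits
  have hβ : betaTwo d A N = 0 := betaTwo_eq_zero_iff.mpr (not_or.mpr ⟨h1N, h2⟩)
  have hβ' : betaTwo d A' N' = 1 := betaTwo_eq_one_iff.mpr (Or.inl hN')
  -- the index sets
  have hfinS : (topPrimesDNL d A).Finite := (topPrimesNL_finite p hctx).subset (topPrimesDNL_subset_topPrimesNL d A)
  set ι : Ideal (MvPowerSeries (Fin 3) k) → Ideal (MvPowerSeries (Fin 3) k) := fun P' => P'.comap Φ with hιdef
  have hιmem : ∀ P' ∈ topPrimesDNL d A', ι P' ∈ topPrimesDNL d A := by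
    intro P' hP'
    obtain ⟨⟨hP'top, hdim'⟩, hX0', hX1'⟩ := hP'
    haveI := hP'top.1
    obtain ⟨hdim, -⟩ := hB3 P' hdim' hX1'
    have htop : ι P' ∈ topPrimes d A := hB4 P' hP'top hX1'
    have hX0 : (X 0 : MvPowerSeries (Fin 3) k) ∉ ι P' := by
      rw [hιdef, Ideal.mem_comap]; show Φ (X 0) ∉ P'; rw [hΦX0]; exact hX0'
    exact ⟨⟨htop, hdim⟩, hX0, hNL _ htop hdim hX0⟩
  have hinjOn : Set.InjOn ι (topPrimesDNL d A') := by
    intro P' hP' Q' hQ' h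
    exact hinj P' Q' hP'.1.1.1 hQ'.1.1.1 hP'.1.2 hQ'.1.2 hP'.2.2 hQ'.2.2 h
  have hfinS' : (topPrimesDNL d A').Finite :=
    Set.Finite.of_finite_image (hfinS.subset (fun P hP => by obtain ⟨P', hP', rfl⟩ := hP; exact hιmem P' hP')) hinjOn
  set S := hfinS.toFinset with hSdef
  set S' := hfinS'.toFinset with hS'def
  have hmemS : ∀ {P}, P ∈ S ↔ P ∈ topPrimesDNL d A := fun {P} => Set.Finite.mem_toFinset _
  have hmemS' : ∀ {P'}, P' ∈ S' ↔ P' ∈ topPrimesDNL d A' := fun {P'} => Set.Finite.mem_toFinset _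
  -- per-branch values: `a′ = a`, `b′ = v_P(u₂ − u₁h₀)`
  have hvals : ∀ P' ∈ topPrimesDNL d A',
      branchVal P' (X 0) ≠ ⊤ ∧ branchVal P' (X 1) ≠ ⊤ ∧ 1 ≤ branchVal P' (X 0) ∧ 1 ≤ branchVal P' (X 1) ∧
      branchVal P' (X 0) = branchVal (ι P') (X 0) ∧ branchVal P' (X 1) = branchVal (ι P') (X 1 - X 0 * toThree h₀) := by
    intro P' hP'
    obtain ⟨⟨hP'top, hdim'⟩, hX0', hX1'⟩ := hP'
    haveI := hP'top.1
    obtain ⟨-, hval⟩ := hB3 P' hdim' hX1'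
    refine ⟨(branchVal_eq_top_iff_of_dim hdim' _).not.mpr hX0', (branchVal_eq_top_iff_of_dim hdim' _).not.mpr hX1',
      one_le_branchVal_X_of_dim hdim' 0, one_le_branchVal_X_of_dim hdim' 1, ?_, ?_⟩
    · rw [hιdef]; show branchVal P' (X 0) = branchVal (P'.comap Φ) (X 0); rw [hval, hΦX0]
    · rw [hιdef]; show _ = branchVal (P'.comap Φ) (X 1 - X 0 * toThree h₀); rw [hval, hΦℓ]
  -- the graph prime dies
  have hΓdying : PΓ ∈ S.filter (fun Q => Q ∉ S'.image ι) := by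
    refine mem_filter_not_mem_image.mpr ⟨hmemS.mpr hPΓD, fun Q' hQ' hQ => ?_⟩
    obtain ⟨-, hb', -, -, -, hbb⟩ := hvals Q' (hmemS'.mp hQ')
    apply hb'
    rw [hbb, hQ, branchVal_eq_top_iff_of_dim hPΓD.1.2]
    exact hℓΓ
  -- charges: the births are paid by the pair term with the graph prime
  have hc : ∀ P' ∈ S', charge d A' N' P' + 1 ≤ charge d A N (ι P') +
      2 * ∑ Q ∈ S.filter (fun Q => Q ∉ S'.image ι), ((pairVal (ι P') Q).toNat + (pairVal Q (ι P')).toNat) := by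
    intro P' hP'
    have hP'm := hmemS'.mp hP'
    obtain ⟨ha', hb', h1a, h1b, haa, hbb⟩ := hvals P' hP'm
    haveI := hP'm.1.1.1
    haveI : (ι P').IsPrime := (hιmem P' hP'm).1.1.1
    have hne : ι P' ≠ PΓ := (mem_filter_not_mem_image.mp hΓdying).2 P' hP'
    have hpair : branchVal (ι P') (X 1 - X 0 * toThree h₀) ≤ pairVal (ι P') PΓ := by
      rw [pairVal]
      refine le_iInf fun g => ?_
      obtain ⟨g, hgΓ, hgP⟩ := g
      obtain ⟨q, hq⟩ := dvd_of_toThree_mem hPΓNL.2.1 hh₀ hℓΓ hgΓ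
      show branchVal (ι P') (X 1 - X 0 * toThree h₀) ≤ branchVal (ι P') (toThree g)
      have hg3 : toThree g = (X 1 - X 0 * toThree h₀) * toThree q := by
        rw [hq, map_mul, map_sub, map_mul, toThree_X, toThree_X]; rfl
      rw [hg3, branchVal_mul_of_dim (hιmem P' hP'm).1.2]
      exact le_self_add
    have hfinpair : pairVal (ι P') PΓ < ⊤ := hD3 _ _ (hιmem P' hP'm).1.1 hPΓD.1.1 hne (hιmem P' hP'm).1.2 hPΓD.1.2
    have hsingle : (pairVal (ι P') PΓ).toNat + (pairVal PΓ (ι P')).toNat ≤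
        ∑ Q ∈ S.filter (fun Q => Q ∉ S'.image ι), ((pairVal (ι P') Q).toNat + (pairVal Q (ι P')).toNat) :=
      Finset.single_le_sum (f := fun Q => (pairVal (ι P') Q).toNat + (pairVal Q (ι P')).toNat) (fun _ _ => Nat.zero_le _) hΓdying
    have hb'le : (branchVal P' (X 1)).toNat ≤ (pairVal (ι P') PΓ).toNat := by
      rw [hbb]; exact ENat.toNat_le_toNat hpair hfinpair.ne
    have haa' : (branchVal P' (X 0)).toNat = (branchVal (ι P') (X 0)).toNat := by rw [haa]
    have h1a' := one_le_toNat h1a ha'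
    have h1b' := one_le_toNat h1b hb'
    rw [charge_eq d A' N', hβ', charge_eq d A N, hβ, branchMult, toNat_min_of_ne_top ha' hb', zero_mul, add_zero]
    have hκ' := kappa_le_one P'
    omega
  -- surviving pairs do not increase (`u = 1`)
  have hq : ∀ P' ∈ S', ∀ Q' ∈ S', P' ≠ Q' → (pairVal P' Q').toNat ≤ (pairVal (ι P') (ι Q')).toNat := by
    intro P' hP' Q' hQ' hne
    have hP'm := hmemS'.mp hP'
    have hQ'm := hmemS'.mp hQ'
    haveI := hP'm.1.1.1
    haveI := hQ'm.1.1.1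
    obtain ⟨-, hval⟩ := hB3 P' hP'm.1.2 hP'm.2.2
    have hle : pairVal P' Q' + branchVal P' 1 ≤ pairVal (ι P') (ι Q') :=
      pairVal_add_le_of_transport Φ.toRingHom φ₂ hΦ₂ hP'm.1.2 rfl rfl (fun f => (hval f).symm ▸ rfl) 1
        (fun h => hQ'm.1.1.1.ne_top ((Ideal.eq_top_iff_one _).mpr h)) fun g _ => ⟨φ₂ g, by rw [one_mul]⟩
    have hιne : ι P' ≠ ι Q' := fun h => hne (hinjOn hP'm hQ'm h)
    have hfin : pairVal (ι P') (ι Q') < ⊤ :=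
      hD3 _ _ (hιmem P' hP'm).1.1 (hιmem Q' hQ'm).1.1 hιne (hιmem P' hP'm).1.2 (hιmem Q' hQ'm).1.2
    exact ENat.toNat_le_toNat (le_trans le_self_add hle) hfin.ne
  -- the comparison
  have hιS : ∀ P' ∈ S', ι P' ∈ S := fun P' hP' => hmemS.mpr (hιmem P' (hmemS'.mp hP'))
  have hinjS : Set.InjOn ι S' := fun P' hP' Q' hQ' h => hinjOn (hmemS'.mp hP') (hmemS'.mp hQ') h
  have hmain := budget_comparison S' S ι hιS hinjS (charge d A' N') (fun _ => 1) (charge d A N)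
    (fun P' Q' => (pairVal P' Q').toNat) (fun P Q => (pairVal P Q).toNat) hq hc
  rw [conflictBudgetD_eq_sum hfinS' N', conflictBudgetD_eq_sum hfinS N, ← hSdef, ← hS'def]
  omega

end Step

end TOT2Branch

end Summit.ResolutionOfSingularities.ResolutionOfSingularities.Theorems

end
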